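import Mathlib.MeasureTheory.Group.Integral
import Literature.Analysis.FluidPDE.DissipatesAtScale
import Literature.Analysis.FluidPDE.RapidDecayLemmas
import Literature.Analysis.FluidPDE.ClassicalSolutionGalilean
import Summits.NavierStokesRegularity.NavierStokesRegularity.Theorems.SelfMixingDichotomyCoherentScaleExclusionMixTranslate
import HarnessLib

/-!
# Crux `SelfMixingDichotomy.CoherentScaleExclusion` (stmt-NavierStokesRegularity-1423), line
  `registered`: stub INV3 `stub_dissipatesAtScale_galilean` — Galilean invariance of the scalar
  dissipation factor `DissipatesAtScale` (uniform sweeping does not mix)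

Support file (`--supports stmt-NavierStokesRegularity-1423`) of the line lead c3. The route's MIX
functional `DissipatesAtScale u T x₀ r δ` (every admissible scalar `θ` — jointly smooth with
uniform rapid decay on the slab `S × ℝ³`, `S = [a, b]`, `a = T − r²`, `b = T − r²/2`, solving
`∂ₜθ + ⟪u, ∇θ⟫ = Δθ` there with datum `θ(a)` supported in `B_r(x₀)` — keeps at most the fraction
`δ` of its `L²` norm: `∫ θ(b)² ≤ δ² ∫ θ(a)²`) is invariant under the Galilean boost by a constant
velocity `c` starting at the initial time `a` of the window:

  `DissipatesAtScale u T x₀ r δ ↔ DissipatesAtScale ((t, y) ↦ u t (y + (t − a) c) − c) T x₀ r δ`.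

Proof. One transfer lemma `mixGalilean_of_boost`: if the boosted drift
`v' t y = v t (y + (t − a) c) − c` dissipates at `(T, x₀)`, so does `v`. Given a scalar `θ`
admissible for `v`, the boosted scalar `θ' t y = θ t (y + (t − a) c)` is admissible for `v'`:
* joint smoothness: `IsSmoothSpaceTimeOn.comp_add_curve` (the path `t ↦ (t − a) c` is smooth);
* uniform rapid decay (`mixGalilean_hasUniformRapidDecayOn_boost`): the boost is the shear
  `L (t, y) = (t, y + t c)`, a continuous linear automorphism of `ℝ × ℝ³` preserving the slab
  `S × ℝ³`, followed by the constant translation by `−a c`; the within-slab derivatives transform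
  by `ContinuousLinearEquiv.iteratedFDerivWithin_comp_right` (norm factor `‖L‖ⁿ`,
  `ContinuousMultilinearMap.norm_compContinuousLinearMap_le`) and by the INV1 lemma
  `mixTranslate_hasUniformRapidDecayOn_comp_add`; the polynomial weight moves by
  `1 + ‖y‖ ≤ (1 + M)(1 + ‖y + t c‖)` with `M = max(|a|, |b|) ‖c‖` (this needs `a < b`, i.e.
  `r ≠ 0`; at `r = 0` both sides hold outright by `dissipatesAtScale_zero_radius`);
* the equation (`mixGalilean_equation_boost`): by the chain rule along the moving point
  (`IsSmoothSpaceTimeOn.hasDerivWithinAt_comp_curve`)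
  `∂ₜθ'(t, y) = ∂ₜθ(t, x) + Dθ(t, x)[c]`, `x = y + (t − a) c`, while `∇θ'(t, y) = ∇θ(t, x)`
  (`mixTranslate_gradient_comp_add`), `Δθ'(t, y) = Δθ(t, x)` (`laplacian_comp_add_right`) and
  `⟪v − c, ∇θ⟫ = ⟪v, ∇θ⟫ − Dθ[c]` (`inner_gradient_left`), so the transport terms cancel;
* the datum is unchanged (`(a − a) c = 0`), hence so is its support;
and the two whole-space integrals are translation invariant (`integral_add_right_eq_self`).
The backward implication of the stub is the transfer lemma for `c`; the forward one is the
transfer lemma for `−c` applied to the boosted drift, since boosting by `c` and then by `−c`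
returns the original drift (`DissipatesAtScale.congr`).
-/

noncomputable section

open MeasureTheory Set Function Metric
open scoped ContDiff Laplacian Pointwise RealInnerProductSpace

-- `Summit = Problem` for this summit; the tree lakefile sets `weak.linter.dupNamespace = false`.
set_option linter.dupNamespace false

namespace Summit.NavierStokesRegularity.NavierStokesRegularity.Theorems

open Literature.Analysis.FluidPDE

/-- **Uniform rapid decay is preserved by a linear shear of space–time.** On a time set `S` of
unique differentiability on which `‖t • c‖ ≤ M`, if `w` has uniform rapid decay of all
within-slab derivatives on `S × X`, so does `(t, y) ↦ w t (y + t • c)`: with the continuous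
linear automorphism `L (t, y) = (t, y + t • c)` of `ℝ × X` (which preserves the slab `S × X`)
one has `uncurry (w ∘ shear) = uncurry w ∘ L`, so the within-slab `n`-th derivative at `(t, y)`
is the one of `w` at `(t, y + t • c)` composed with `L` in each slot
(`ContinuousLinearEquiv.iteratedFDerivWithin_comp_right`), of norm at most `‖L‖ⁿ` times as large,
and `(1 + ‖y‖)^K ≤ (1 + M)^K (1 + ‖y + t • c‖)^K`. -/
theorem mixGalilean_hasUniformRapidDecayOn_comp_add_smul
    {X : Type*} [NormedAddCommGroup X] [NormedSpace ℝ X]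
    {F : Type*} [NormedAddCommGroup F] [NormedSpace ℝ F]
    {S : Set ℝ} (hS : UniqueDiffOn ℝ S) {w : ℝ → X → F} (hd : HasUniformRapidDecayOn S w)
    (c : X) {M : ℝ} (hM : ∀ t ∈ S, ‖t • c‖ ≤ M) :
    HasUniformRapidDecayOn S (fun t y => w t (y + t • c)) := by
  -- the shear `L (t, y) = (t, y + t • c)` as a continuous linear automorphism of `ℝ × X`
  let L : (ℝ × X) ≃L[ℝ] (ℝ × X) := (ContinuousLinearEquiv.refl ℝ ℝ).skewProd
    (ContinuousLinearEquiv.refl ℝ X) (ContinuousLinearMap.toSpanSingleton ℝ c)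
  have hLapply : ∀ (t : ℝ) (y : X), L (t, y) = (t, y + t • c) := fun t y => rfl
  have hfun : uncurry (fun t y => w t (y + t • c)) = uncurry w ∘ L := by
    funext z
    obtain ⟨t, y⟩ := z
    simp [hLapply]
  have hpre : L ⁻¹' (S ×ˢ (univ : Set X)) = S ×ˢ univ := by
    ext ⟨t, y⟩
    simp [hLapply]
  have hU : UniqueDiffOn ℝ (S ×ˢ (univ : Set X)) := hS.prod uniqueDiffOn_univ
  intro n K
  obtain ⟨C, hC⟩ := hd n K
  refine ⟨‖(L : ℝ × X →L[ℝ] ℝ × X)‖ ^ n * (1 + M) ^ K * C, fun t ht y => ?_⟩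
  have hM0 : 0 ≤ M := (norm_nonneg _).trans (hM t ht)
  have hmem : L (t, y) ∈ S ×ˢ (univ : Set X) := by
    rw [hLapply]
    exact ⟨ht, mem_univ _⟩
  have hkey : iteratedFDerivWithin ℝ n (uncurry (fun t y => w t (y + t • c))) (S ×ˢ univ) (t, y) =
      (iteratedFDerivWithin ℝ n (uncurry w) (S ×ˢ univ) (t, y + t • c)).compContinuousLinearMap
        fun _ => (L : ℝ × X →L[ℝ] ℝ × X) := by
    have h := L.iteratedFDerivWithin_comp_right (uncurry w) hU hmem n
    rw [hpre] at h
    rw [hfun, h, hLapply]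
  have hnorm : ‖iteratedFDerivWithin ℝ n (uncurry (fun t y => w t (y + t • c))) (S ×ˢ univ) (t, y)‖ ≤
      ‖(L : ℝ × X →L[ℝ] ℝ × X)‖ ^ n *
        ‖iteratedFDerivWithin ℝ n (uncurry w) (S ×ˢ univ) (t, y + t • c)‖ := by
    rw [hkey]
    refine (ContinuousMultilinearMap.norm_compContinuousLinearMap_le _ _).trans (le_of_eq ?_)
    rw [Finset.prod_const, Finset.card_univ, Fintype.card_fin, mul_comm]
  have hya : ‖y‖ ≤ ‖y + t • c‖ + M := by
    calc ‖y‖ = ‖(y + t • c) - t • c‖ := by rw [add_sub_cancel_right]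
      _ ≤ ‖y + t • c‖ + ‖t • c‖ := norm_sub_le _ _
      _ ≤ ‖y + t • c‖ + M := by
        gcongr
        exact hM t ht
  have hw1 : 1 + ‖y‖ ≤ (1 + M) * (1 + ‖y + t • c‖) := by
    nlinarith [hya, mul_nonneg hM0 (norm_nonneg (y + t • c))]
  have hw : (1 + ‖y‖) ^ K ≤ (1 + M) ^ K * (1 + ‖y + t • c‖) ^ K := by
    rw [← mul_pow]
    exact pow_le_pow_left₀ (by positivity) hw1 K
  have hMK : 0 ≤ (1 + M) ^ K := pow_nonneg (by linarith) K
  calc (1 + ‖y‖) ^ K * ‖iteratedFDerivWithin ℝ n (uncurry (fun t y => w t (y + t • c))) (S ×ˢ univ) (t, y)‖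
      ≤ ((1 + M) ^ K * (1 + ‖y + t • c‖) ^ K) *
          (‖(L : ℝ × X →L[ℝ] ℝ × X)‖ ^ n *
            ‖iteratedFDerivWithin ℝ n (uncurry w) (S ×ˢ univ) (t, y + t • c)‖) :=
        mul_le_mul hw hnorm (norm_nonneg _) (mul_nonneg hMK (by positivity))
    _ = ‖(L : ℝ × X →L[ℝ] ℝ × X)‖ ^ n * (1 + M) ^ K *
          ((1 + ‖y + t • c‖) ^ K *
            ‖iteratedFDerivWithin ℝ n (uncurry w) (S ×ˢ univ) (t, y + t • c)‖) := by
        ring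
    _ ≤ ‖(L : ℝ × X →L[ℝ] ℝ × X)‖ ^ n * (1 + M) ^ K * C :=
        mul_le_mul_of_nonneg_left (hC t ht (y + t • c)) (mul_nonneg (by positivity) hMK)

/-- **Uniform rapid decay is preserved by a Galilean boost.** For `a < b` and a constant velocity
`c`, if `w` has uniform rapid decay of all within-slab derivatives on `[a, b] × X`, so does the
boosted field `(t, y) ↦ w t (y + (t − a) • c)`: the boost is the linear shear
`(t, y) ↦ (t, y + t • c)` (`mixGalilean_hasUniformRapidDecayOn_comp_add_smul`, with
`‖t • c‖ ≤ max |a| |b| · ‖c‖` on `[a, b]`, a set of unique differentiability) followed by the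
constant translation by `−(a • c)` (`mixTranslate_hasUniformRapidDecayOn_comp_add`). -/
theorem mixGalilean_hasUniformRapidDecayOn_boost
    {X : Type*} [NormedAddCommGroup X] [NormedSpace ℝ X]
    {F : Type*} [NormedAddCommGroup F] [NormedSpace ℝ F]
    {a b : ℝ} (hab : a < b) {w : ℝ → X → F} (hd : HasUniformRapidDecayOn (Icc a b) w) (c : X) :
    HasUniformRapidDecayOn (Icc a b) (fun t y => w t (y + (t - a) • c)) := by
  have h1 : HasUniformRapidDecayOn (Icc a b) (fun t y => w t (y + t • c)) :=
    mixGalilean_hasUniformRapidDecayOn_comp_add_smul (uniqueDiffOn_Icc hab) hd c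
      (M := max |a| |b| * ‖c‖) fun t ht => by
        rw [norm_smul, Real.norm_eq_abs]
        exact mul_le_mul_of_nonneg_right (abs_le_max_abs_abs ht.1 ht.2) (norm_nonneg c)
  have hfun : (fun t y => w t (y + (t - a) • c)) =
      fun t y => (fun s z => w s (z + s • c)) t (y + -(a • c)) := by
    funext t y
    simp only [sub_smul]
    congr 1
    abel
  rw [hfun]
  exact mixTranslate_hasUniformRapidDecayOn_comp_add h1 (-(a • c))

/-- **One-sided time derivative of a boosted field.** For `w` jointly smooth on `S × X`, `t ∈ S`
a point of unique differentiability of `S`, a time origin `a` and a constant velocity `c`: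
`∂ₜ[(s, z) ↦ w s (z + (s − a) • c)](t, y) = ∂ₜw(t, x) + D(w t)(x)[c]`, `x = y + (t − a) • c`
(all time derivatives one-sided within `S`; chain rule along the moving point
`s ↦ y + (s − a) • c`, `IsSmoothSpaceTimeOn.hasDerivWithinAt_comp_curve`). -/
theorem mixGalilean_timeDerivWithin_boost
    {X : Type*} [NormedAddCommGroup X] [NormedSpace ℝ X]
    {F : Type*} [NormedAddCommGroup F] [NormedSpace ℝ F]
    {S : Set ℝ} {w : ℝ → X → F} (h : IsSmoothSpaceTimeOn S w) (a : ℝ) (c : X)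
    {t : ℝ} (ht : t ∈ S) (hS : UniqueDiffWithinAt ℝ S t) (y : X) :
    timeDerivWithin S (fun s z => w s (z + (s - a) • c)) t y =
      timeDerivWithin S w t (y + (t - a) • c) + fderiv ℝ (w t) (y + (t - a) • c) c := by
  have hγ : HasDerivWithinAt (fun s : ℝ => y + (s - a) • c) c S t := by
    have h1 : HasDerivAt (fun s : ℝ => (s - a) • c) ((1 : ℝ) • c) t :=
      ((hasDerivAt_id t).sub_const a).smul_const c
    rw [one_smul] at h1
    exact (h1.const_add y).hasDerivWithinAt
  have h2 := h.hasDerivWithinAt_comp_curve ht hS hγ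
  rw [timeDerivWithin_apply]
  exact h2.derivWithin hS

/-- **The advection–diffusion equation in the boosted frame.** For `a < b`, if `θ` (jointly smooth
on `[a, b] × ℝ³`) solves `∂ₜθ + ⟪v, ∇θ⟫ = Δθ` on `[a, b] × ℝ³` (time derivative within
`[a, b]`), then the boosted scalar `θ' t y = θ t (y + (t − a) • c)` solves
`∂ₜθ' + ⟪v', ∇θ'⟫ = Δθ'` for the boosted drift `v' t y = v t (y + (t − a) • c) − c`: with
`x = y + (t − a) • c`, `∂ₜθ'(t, y) = ∂ₜθ(t, x) + Dθ(t, x)[c]` (`mixGalilean_timeDerivWithin_boost`),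
`∇θ'(t, y) = ∇θ(t, x)`, `Δθ'(t, y) = Δθ(t, x)` (translation covariance at fixed `t`), and
`⟪v − c, ∇θ⟫ = ⟪v, ∇θ⟫ − Dθ[c]` (`inner_gradient_left`), so the transport terms cancel. -/
theorem mixGalilean_equation_boost {a b : ℝ} (hab : a < b)
    {v : ℝ → EuclideanSpace ℝ (Fin 3) → EuclideanSpace ℝ (Fin 3)}
    {θ : ℝ → EuclideanSpace ℝ (Fin 3) → ℝ} (hs : IsSmoothSpaceTimeOn (Icc a b) θ)
    (c : EuclideanSpace ℝ (Fin 3))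
    (he : ∀ t ∈ Icc a b, ∀ x : EuclideanSpace ℝ (Fin 3),
      timeDerivWithin (Icc a b) θ t x + inner ℝ (v t x) (gradient (θ t) x) =
        Laplacian.laplacian (θ t) x) :
    ∀ t ∈ Icc a b, ∀ y : EuclideanSpace ℝ (Fin 3),
      timeDerivWithin (Icc a b) (fun s z => θ s (z + (s - a) • c)) t y
          + inner ℝ (v t (y + (t - a) • c) - c) (gradient (fun z => θ t (z + (t - a) • c)) y)
        = Laplacian.laplacian (fun z => θ t (z + (t - a) • c)) y := by
  intro t ht y
  have e := he t ht (y + (t - a) • c)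
  rw [mixGalilean_timeDerivWithin_boost hs a c ht (uniqueDiffOn_Icc hab t ht) y,
    mixTranslate_gradient_comp_add, laplacian_comp_add_right, inner_sub_left,
    real_inner_comm (gradient (θ t) (y + (t - a) • c)) c, inner_gradient_left]
  linarith

/-- **Transfer of the dissipation factor from a boosted frame.** If the Galilean boost
`(t, y) ↦ v t (y + (t − a) • c) − c` (`a = T − r²`, constant velocity `c`) of the drift `v`
dissipates at scale `r` with factor `δ` at `(T, x₀)`, then so does `v`: a scalar `θ` admissible
for `v` boosts to the scalar `θ' t y = θ t (y + (t − a) • c)` admissible for the boosted drift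
(joint smoothness `IsSmoothSpaceTimeOn.comp_add_curve`, uniform rapid decay
`mixGalilean_hasUniformRapidDecayOn_boost`, the equation `mixGalilean_equation_boost`, and the
same datum at `t = a` since `(a − a) • c = 0`), with the same two whole-space `L²` integrals
(`integral_add_right_eq_self`). At `r = 0` both predicates hold outright
(`dissipatesAtScale_zero_radius`). -/
theorem mixGalilean_of_boost
    {v : ℝ → EuclideanSpace ℝ (Fin 3) → EuclideanSpace ℝ (Fin 3)} {T : ℝ}
    {x₀ : EuclideanSpace ℝ (Fin 3)} {r δ : ℝ} (c : EuclideanSpace ℝ (Fin 3))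
    (h : DissipatesAtScale (fun t y => v t (y + (t - (T - r ^ 2)) • c) - c) T x₀ r δ) :
    DissipatesAtScale v T x₀ r δ := by
  rcases eq_or_ne r 0 with rfl | hr
  · exact dissipatesAtScale_zero_radius
  intro θ hs hd he hsupp
  have hab : T - r ^ 2 < T - r ^ 2 / 2 := by
    have hr2 : 0 < r ^ 2 := by positivity
    linarith
  have key := h (fun t y => θ t (y + (t - (T - r ^ 2)) • c))
    (hs.comp_add_curve (ξ := fun t => (t - (T - r ^ 2)) • c)
      ((contDiff_id.sub contDiff_const).smul contDiff_const))
    (mixGalilean_hasUniformRapidDecayOn_boost hab hd c)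
    (mixGalilean_equation_boost hab hs c he) ?_
  · -- the two integrals are those of `θ` (translation invariance of Lebesgue measure)
    have i1 : ∫ x, (θ (T - r ^ 2 / 2) (x + (T - r ^ 2 / 2 - (T - r ^ 2)) • c)) ^ 2 =
        ∫ x, (θ (T - r ^ 2 / 2) x) ^ 2 :=
      integral_add_right_eq_self (μ := (volume : Measure (EuclideanSpace ℝ (Fin 3))))
        (fun x => (θ (T - r ^ 2 / 2) x) ^ 2) _
    have i2 : ∫ x, (θ (T - r ^ 2) (x + (T - r ^ 2 - (T - r ^ 2)) • c)) ^ 2 =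
        ∫ x, (θ (T - r ^ 2) x) ^ 2 :=
      integral_add_right_eq_self (μ := (volume : Measure (EuclideanSpace ℝ (Fin 3))))
        (fun x => (θ (T - r ^ 2) x) ^ 2) _
    rw [← i1, ← i2]
    exact key
  · -- the datum is unchanged: at `t = T - r²` the shift is `0 • c = 0`
    intro x hx
    apply hsupp
    rw [Function.mem_support] at hx ⊢
    simpa using hx

/-- **INV3 — Galilean invariance of `DissipatesAtScale`** (registered sub-goal
`stub_dissipatesAtScale_galilean` of the crux `CoherentScaleExclusion`, line `registered`,
lead c3): uniform sweeping does not mix. The scalar dissipation factor of `u` at `(T, x₀)` equals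
that of the Galilean-boosted drift `(t, y) ↦ u t (y + (t − a) • c) − c`, `a = T − r²` (the frame
moving with constant velocity `c` from the initial time of the window, so that the datum and its
support are unchanged): admissible scalars correspond under `θ ↦ θ(t, · + (t − a) • c)` (joint
smoothness, uniform rapid decay with sheared polynomial weights, the material time derivative
`∂ₜθ + Dθ[c]` against the drift correction `−⟪c, ∇θ⟫`, translation covariance of `∇`, `Δ` and of
the whole-space integrals). The backward direction is `mixGalilean_of_boost c`; the forward one is
`mixGalilean_of_boost (−c)` applied to the boosted drift, boosting back by `−c` returning `u`. -/
theorem stub_dissipatesAtScale_galilean :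
    ∀ (u : ℝ → EuclideanSpace ℝ (Fin 3) → EuclideanSpace ℝ (Fin 3)) (T : ℝ) (x₀ c : EuclideanSpace ℝ (Fin 3))
      (r δ : ℝ),
      DissipatesAtScale u T x₀ r δ ↔
        DissipatesAtScale (fun t y => u t (y + (t - (T - r ^ 2)) • c) - c) T x₀ r δ := by
  intro u T x₀ c r δ
  refine ⟨fun h => mixGalilean_of_boost (-c) (h.congr fun t _ y => ?_), mixGalilean_of_boost c⟩
  simp [smul_neg]

end Summit.NavierStokesRegularity.NavierStokesRegularity.Theorems
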